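import Summits.ABC.IUTFork.Repair.CandInternal2RealLabels
import HarnessLib

/-!
# IUT REPAIR BRANCH (rung LADDER-ABC:A2.RP → A2.RESCUE-H), class (i) INTERNAL, sub-cell B0, seat rp-d2 — `CandInternal2RealStrata`: the REAL
# label window of RP-I06⋆ RESOLVED PER PLACE-TYPE STRATUM (odd `p` / `v | 2` / top label / all labels) — the cell-deciding corollaries

PROOF-ONLY file (D-0012; 0 definitions, 0 `Prop` facts) of the abc-iut cell, IUT REPAIR branch; seat abc-iut-rp-d2 gen 3 (D-0079 R-H
numerics/kernel-eval hand; `plan/rescue-H/SEATS.tsv` row «price author: height/depth form of the price at genuine data → per-stratum»).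
TAKES NO SIDE on [IUTchIII] Cor. 3.12 or on any author; classical `p`-adic analysis over this seat's `CandInternal2RealLabels` (p450037: the
two-sided window `(n−1)·h ≤ c − a_e ⟹ q ∈ q^n·ℐ_K ⟹ (n−1)·h ≤ b_e + c` at the real log-shell `ℐ_K = (p*)⁻¹·log_p(𝒪_K^×)`, `‖q‖ = p^{−h}`,
`a_e`/`b_e` = abc-iut-S1's [IUTchIV] Prop. 1.2 (i) exponents, `c = ord_p(p*)`); standard axioms.

THE STRATA of `plan/rescue-H/I06STAR-TABLE.tsv` (column `type_v`), for the INTENDED Kummer datum — a `2l`-th ROOT `q̲_v` of the Tate parameter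
([IUTchII] Introduction p. 2 l. 50), `‖q̲‖^{2l} = p^{−H}`, `H = ord_p(q_E)`:
* §1 DECIDED-NEG cells (any stratum): `not_mem_pow_smul_logShell_of_lt` / `_of_root_lt` — `N·(b_e + c) < (n−1)·H ⟹ q̲ ∉ q̲^n·ℐ_K`.
* §2 ODD `p` (`type_v ∈ {unram-odd, ram-odd, v | l}`, `c = 1`): `mem_of_height_le_odd` (`(n−1)·h ≤ 1 − a_e` suffices), `height_le_of_mem_odd`
  (`≤ 1 + b_e` necessary), `not_mem_of_lt_odd`; the unramified case `e = 1` is gen 0's `CandInternal2Real.not_mem_pow_smul_logShell_of_unramified`.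
* §3 `v | 2` (`c = 2`, `a = 2`): `logRadiusA_two`, `lowerEdge_two` — the lower edge is EMPTY (`c − a = 0`): Prop. 1.2 (i) certifies NO positive
  cell over `2` beyond `𝒪_K ⊆ ℐ_K`; `height_le_of_mem_two` (`(n−1)·h ≤ 2 + b_e` necessary) decides negatives only.
* §4 TOP LABEL `j = l⋇ = k` (`l = 2k+1`): **`not_mem_topLabel_of_large_l`** — `8l·(b_e + c) < (l−3)(l+1)·H ⟹ q̲ ∉ q̲^{l⋇²}·ℐ_K`: the negative of
  the [IUTchIV] regime (large `l`) at EVERY bad place, the ramification entering only through `b_e ≤ log(pe/(p−1))/log p − 1/e`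
  (`CandInternal2RealLabels.logRadiusB_le`).
* §5 ALL LABELS `j ≤ J` (odd `p ≥ 5` useful): **`allLabels_mem_of_le`** — `0 ≤ H`, `(J²−1)·H ≤ 2l·(1 − 1/(p−2) − 1/e) ⟹ ∀ j ≤ J, q̲ ∈ q̲^{j²}·ℐ_K`;
  worked template `allLabels_mem_l5` (`l = 5`, `p ≥ 5`, `e ≥ 10`, `H ≤ 1`: both labels DECIDED-POS).
READING FOR THE TABLE (neutral): with `ord_w(q̲_v) = e_w·H/(2l)` and `d_w ∈ [e_w(c − a_{e_w}), e_w(b_{e_w} + c)]` the sign of `slack_j` is that of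
`2l·κ_w − (j²−1)·H`, `κ_w ∈ [c − a, b + c]`; per stratum: odd `p` window `[1 − a_e, 1 + b_e]` (closed at `1 − 1/e` when `e ≤ p − 2`), `v | 2` window
`[0, 2 + b_e]` (no certified positives), top label negative once `l ≳ 8(b_e + c)/H`, low labels positive while `(j²−1)·H ≤ 2l(1 − 1/(p−2) − 1/e)`.
Nothing here is a verdict on any author's reading; no side taken. [claim: Mochizuki2012, status: disputed] for the quoted readings;
[cite: MochizukiAbsTopIII2015, Def 5.4 (iii) p. 126].
-/

noncomputable section

namespace Summit.ABC.IUTFork.Repair.CandInternal2RealStrata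

open Set Metric
open scoped Pointwise
open Literature.AnabelianGeometry.AbsoluteAnabelian Literature.IUT.LogThetaLattice Literature.IUT.LogVolume
  Summit.ABC.IUTFork.Repair.CandInternal2Real Summit.ABC.IUTFork.Repair.CandInternal2RealLabels

/-! ## 0. Arithmetic of the exponents at the strata -/

section Exponents

/-- Odd `p`: `c = ord_p(p*) = 1`. [cite: MochizukiAbsTopIII2015, Def 5.4 (iii) p. 126] -/
theorem pstarExp_of_ne_two {p : ℕ} (hp : p ≠ 2) : ((if p = 2 then 2 else 1 : ℕ) : ℝ) = 1 := by
  rw [if_neg hp]; simp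

/-- `p = 2`: `c = 2`. [cite: MochizukiAbsTopIII2015, Def 5.4 (iii) p. 126] -/
theorem pstarExp_two : ((if (2 : ℕ) = 2 then 2 else 1 : ℕ) : ℝ) = 2 := by
  rw [if_pos rfl]; simp

/-- `p = 2`: `a = 2` ([IUTchIV] Prop. 1.2: «`a_i := 2` if `p_i = 2`»). [claim: Mochizuki2012, status: disputed] -/
theorem logRadiusA_two (e : ℕ) : logRadiusA 2 e = 2 := by
  rw [logRadiusA, if_pos rfl]

/-- **Over `2` the lower edge of the window is EMPTY**: `c − a = 0`. [claim: Mochizuki2012, status: disputed] -/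
theorem lowerEdge_two (e : ℕ) : ((if (2 : ℕ) = 2 then 2 else 1 : ℕ) : ℝ) - logRadiusA 2 e = 0 := by
  rw [pstarExp_two, logRadiusA_two]; norm_num

/-- Odd `p`: the lower edge is `1 − a_e ≥ 1 − 1/(p−2) − 1/e`. [claim: Mochizuki2012, status: disputed] -/
theorem lowerEdge_odd_ge {p e : ℕ} (hp : 2 < p) (he : 1 ≤ e) :
    1 - 1 / ((p : ℝ) - 2) - 1 / e ≤ ((if p = 2 then 2 else 1 : ℕ) : ℝ) - logRadiusA p e := by
  rw [pstarExp_of_ne_two (by omega)]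
  have := logRadiusA_le hp he
  linarith

/-- The upper edge is at most `c + log(pe/(p−1))/log p − 1/e`. [claim: Mochizuki2012, status: disputed] -/
theorem upperEdge_le (p e : ℕ) :
    logRadiusB p e + ((if p = 2 then 2 else 1 : ℕ) : ℝ) ≤
      Real.log ((p : ℝ) * e / ((p : ℝ) - 1)) / Real.log p - 1 / e + ((if p = 2 then 2 else 1 : ℕ) : ℝ) := by
  have := logRadiusB_le p e
  linarith

end Exponents

section Window

variable (p : ℕ) [Fact p.Prime]
variable (K : Type*) [NontriviallyNormedField K] [NormedAlgebra ℚ_[p] K] [IsUltrametricDist K] [ProperSpace K]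

/-! ## 1. DECIDED-NEG cells (any stratum): contrapositives of the upper edge -/

/-- **NEGATIVE CELL, height form**: `b_e + c < (n−1)·h ⟹ q ∉ q^n · ℐ_K`. [cite: MochizukiAbsTopIII2015, Def 5.4 (iii) p. 126] -/
theorem not_mem_pow_smul_logShell_of_lt {q : K} {h : ℝ} (hqh : ‖q‖ = (p : ℝ) ^ (-h)) {n : ℕ}
    (hlt : logRadiusB p (absRamificationIdx p K) + ((if p = 2 then 2 else 1 : ℕ) : ℝ) < ((n : ℝ) - 1) * h) :
    q ∉ q ^ n • logShell (PadicLogOnUnits.ofUnitLog p K) := fun hmem =>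
  (not_le.2 hlt) (height_le_of_mem_pow_smul_logShell p K hqh hmem)

/-- **NEGATIVE CELL, root form** (`‖q̲‖^N = p^{−H}`): `N·(b_e + c) < (n−1)·H ⟹ q̲ ∉ q̲^n · ℐ_K`. [claim: Mochizuki2012, status: disputed] -/
theorem not_mem_pow_smul_logShell_of_root_lt {q : K} {N : ℕ} (hN : 0 < N) {H : ℝ} (hqN : ‖q‖ ^ N = (p : ℝ) ^ (-H)) {n : ℕ}
    (hlt : (N : ℝ) * (logRadiusB p (absRamificationIdx p K) + ((if p = 2 then 2 else 1 : ℕ) : ℝ)) < ((n : ℝ) - 1) * H) :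
    q ∉ q ^ n • logShell (PadicLogOnUnits.ofUnitLog p K) := fun hmem =>
  (not_le.2 hlt) (root_height_le_of_mem_pow_smul_logShell p K hN hqN hmem)

/-! ## 2. ODD `p` (strata unram-odd / ram-odd / `v | l`): `c = 1` -/

/-- **Odd `p`, positive cell**: `(n−1)·h ≤ 1 − a_e ⟹ q ∈ q^n · ℐ_K`. [cite: MochizukiAbsTopIII2015, Def 5.4 (iii) p. 126] -/
theorem mem_of_height_le_odd (hp : p ≠ 2) {q : K} (hq : q ≠ 0) {h : ℝ} (hqh : ‖q‖ = (p : ℝ) ^ (-h)) {n : ℕ}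
    (hle : ((n : ℝ) - 1) * h ≤ 1 - logRadiusA p (absRamificationIdx p K)) :
    q ∈ q ^ n • logShell (PadicLogOnUnits.ofUnitLog p K) := by
  apply mem_pow_smul_logShell_of_height_le p K hq hqh
  rw [pstarExp_of_ne_two hp]
  exact hle

/-- **Odd `p`, necessary side**: `q ∈ q^n · ℐ_K ⟹ (n−1)·h ≤ 1 + b_e`. [cite: MochizukiAbsTopIII2015, Def 5.4 (iii) p. 126] -/
theorem height_le_of_mem_odd (hp : p ≠ 2) {q : K} {h : ℝ} (hqh : ‖q‖ = (p : ℝ) ^ (-h)) {n : ℕ}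
    (hmem : q ∈ q ^ n • logShell (PadicLogOnUnits.ofUnitLog p K)) :
    ((n : ℝ) - 1) * h ≤ 1 + logRadiusB p (absRamificationIdx p K) := by
  have h1 := height_le_of_mem_pow_smul_logShell p K hqh hmem
  rw [pstarExp_of_ne_two hp] at h1
  linarith

/-- **Odd `p`, negative cell**: `1 + b_e < (n−1)·h ⟹ q ∉ q^n · ℐ_K`. [cite: MochizukiAbsTopIII2015, Def 5.4 (iii) p. 126] -/
theorem not_mem_of_lt_odd (hp : p ≠ 2) {q : K} {h : ℝ} (hqh : ‖q‖ = (p : ℝ) ^ (-h)) {n : ℕ}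
    (hlt : 1 + logRadiusB p (absRamificationIdx p K) < ((n : ℝ) - 1) * h) :
    q ∉ q ^ n • logShell (PadicLogOnUnits.ofUnitLog p K) := fun hmem =>
  (not_le.2 hlt) (height_le_of_mem_odd p K hp hqh hmem)

/-- **Odd `p ≥ 5`, explicit positive cell in root form**: `0 ≤ H`, `(n−1)·H ≤ N·(1 − 1/(p−2) − 1/e) ⟹ q̲ ∈ q̲^n · ℐ_K`.
[claim: Mochizuki2012, status: disputed] -/
theorem mem_of_root_le_explicit (hp : 2 < p) {q : K} (hq : q ≠ 0) {N : ℕ} (hN : 0 < N) {H : ℝ} (hqN : ‖q‖ ^ N = (p : ℝ) ^ (-H))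
    {n : ℕ} (hle : ((n : ℝ) - 1) * H ≤ N * (1 - 1 / ((p : ℝ) - 2) - 1 / (absRamificationIdx p K : ℝ))) :
    q ∈ q ^ n • logShell (PadicLogOnUnits.ofUnitLog p K) := by
  apply mem_pow_smul_logShell_of_root p K hq hN hqN
  have hedge := lowerEdge_odd_ge hp (absRamificationIdx_pos p K)
  have hN0 : (0 : ℝ) ≤ N := by positivity
  exact hle.trans (mul_le_mul_of_nonneg_left hedge hN0)

end Window

/-! ## 3. Stratum `v | 2`: only negatives are certified by Prop. 1.2 (i) -/

section OverTwo

variable (K : Type*) [NontriviallyNormedField K] [NormedAlgebra ℚ_[2] K] [IsUltrametricDist K] [ProperSpace K]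

/-- **`v | 2`, necessary side**: `q ∈ q^n · ℐ_K ⟹ (n−1)·h ≤ 2 + b_e` (`c = 2`). [cite: MochizukiAbsTopIII2015, Def 5.4 (iii) p. 126] -/
theorem height_le_of_mem_two {q : K} {h : ℝ} (hqh : ‖q‖ = ((2 : ℕ) : ℝ) ^ (-h)) {n : ℕ}
    (hmem : q ∈ q ^ n • logShell (PadicLogOnUnits.ofUnitLog 2 K)) :
    ((n : ℝ) - 1) * h ≤ 2 + logRadiusB 2 (absRamificationIdx 2 K) := by
  have h1 := height_le_of_mem_pow_smul_logShell 2 K hqh hmem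
  rw [pstarExp_two] at h1
  linarith

/-- **`v | 2`, negative cell**: `2 + b_e < (n−1)·h ⟹ q ∉ q^n · ℐ_K`. [cite: MochizukiAbsTopIII2015, Def 5.4 (iii) p. 126] -/
theorem not_mem_of_lt_two {q : K} {h : ℝ} (hqh : ‖q‖ = ((2 : ℕ) : ℝ) ^ (-h)) {n : ℕ}
    (hlt : 2 + logRadiusB 2 (absRamificationIdx 2 K) < ((n : ℝ) - 1) * h) :
    q ∉ q ^ n • logShell (PadicLogOnUnits.ofUnitLog 2 K) := fun hmem =>
  (not_le.2 hlt) (height_le_of_mem_two K hqh hmem)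

/-- **`v | 2`, the lower edge is trivial**: the hypothesis of `mem_pow_smul_logShell_of_height_le` at `p = 2` reads `(n−1)·h ≤ 0` — Prop. 1.2 (i)
certifies no positive cell over `2` beyond `n·h ≤ h` (i.e. `𝒪_K ⊆ ℐ_K`). [claim: Mochizuki2012, status: disputed] -/
theorem lowerEdge_hypothesis_two (n : ℕ) (h : ℝ) :
    (((n : ℝ) - 1) * h ≤ ((if (2 : ℕ) = 2 then 2 else 1 : ℕ) : ℝ) - logRadiusA 2 (absRamificationIdx 2 K)) ↔ ((n : ℝ) - 1) * h ≤ 0 := by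
  rw [lowerEdge_two]

end OverTwo

/-! ## 4. TOP LABEL `j = l⋇` (`l = 2k + 1`, `l⋇ = k`): the negative of the large-`l` regime at every bad place -/

section TopLabel

variable (p : ℕ) [Fact p.Prime]
variable (K : Type*) [NontriviallyNormedField K] [NormedAlgebra ℚ_[p] K] [IsUltrametricDist K] [ProperSpace K]

/-- `(l−3)(l+1) = 4(l⋇² − 1)` for `l = 2k+1`, `l⋇ = k`. [folklore] -/
theorem top_label_identity (k : ℕ) :
    ((((2 * k + 1 : ℕ) : ℝ)) - 3) * (((2 * k + 1 : ℕ) : ℝ) + 1) = 4 * ((((k ^ 2 : ℕ)) : ℝ) - 1) := by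
  push_cast; ring

/-- **TOP-LABEL NEGATIVE** (`l = 2k+1`, `‖q̲‖^{2l} = p^{−H}`): `8l·(b_e + c) < (l−3)(l+1)·H ⟹ q̲ ∉ q̲^{l⋇²} · ℐ_K`. Ramification enters only through
`b_e ≤ log(pe/(p−1))/log p − 1/e`; for `H ≥ H₀ > 0` the hypothesis holds for every `l` beyond `≈ 8(b_e + c)/H₀ + 2`. [claim: Mochizuki2012, status: disputed] -/
theorem not_mem_topLabel_of_large_l {q : K} (k : ℕ) {H : ℝ} (hqN : ‖q‖ ^ (2 * (2 * k + 1)) = (p : ℝ) ^ (-H))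
    (hlt : 8 * ((2 * k + 1 : ℕ) : ℝ) * (logRadiusB p (absRamificationIdx p K) + ((if p = 2 then 2 else 1 : ℕ) : ℝ)) <
      ((((2 * k + 1 : ℕ) : ℝ)) - 3) * (((2 * k + 1 : ℕ) : ℝ) + 1) * H) :
    q ∉ q ^ (k ^ 2) • logShell (PadicLogOnUnits.ofUnitLog p K) := by
  refine not_mem_pow_smul_logShell_of_root_lt p K (N := 2 * (2 * k + 1)) (by omega) hqN ?_
  rw [top_label_identity] at hlt
  push_cast at hlt ⊢
  linarith

end TopLabel

/-! ## 5. ALL LABELS `j ≤ J`: positive cells at small `(J²−1)·H/(2l)` (odd `p ≥ 5` useful) -/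

section AllLabels

variable (p : ℕ) [Fact p.Prime]
variable (K : Type*) [NontriviallyNormedField K] [NormedAlgebra ℚ_[p] K] [IsUltrametricDist K] [ProperSpace K]

/-- **ALL-LABELS POSITIVE** (`‖q̲‖^{2l} = p^{−H}`, `0 ≤ H`, `p > 2`): `(J²−1)·H ≤ 2l·(1 − 1/(p−2) − 1/e) ⟹ ∀ j ≤ J, q̲ ∈ q̲^{j²} · ℐ_K`.
[claim: Mochizuki2012, status: disputed] -/
theorem allLabels_mem_of_le (hp : 2 < p) {q : K} (hq : q ≠ 0) {l : ℕ} (hl : 0 < l) {H : ℝ} (hH : 0 ≤ H)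
    (hqN : ‖q‖ ^ (2 * l) = (p : ℝ) ^ (-H)) {J : ℕ}
    (hle : (((J ^ 2 : ℕ) : ℝ) - 1) * H ≤ ((2 * l : ℕ) : ℝ) * (1 - 1 / ((p : ℝ) - 2) - 1 / (absRamificationIdx p K : ℝ))) :
    ∀ j ≤ J, q ∈ q ^ (j ^ 2) • logShell (PadicLogOnUnits.ofUnitLog p K) := by
  intro j hj
  apply mem_of_root_le_explicit p K hp hq (by omega) hqN
  have hjJ : ((j ^ 2 : ℕ) : ℝ) ≤ ((J ^ 2 : ℕ) : ℝ) := by exact_mod_cast Nat.pow_le_pow_left hj 2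
  have hmono : (((j ^ 2 : ℕ) : ℝ) - 1) * H ≤ (((J ^ 2 : ℕ) : ℝ) - 1) * H := mul_le_mul_of_nonneg_right (by linarith) hH
  exact hmono.trans hle

/-- **WORKED TEMPLATE (DECIDED-POS)**: `l = 5` (`l⋇ = 2`), `p ≥ 5`, `e ≥ 10`, `0 ≤ H ≤ 1` (e.g. a bad place over `p ≥ 5` with `ord_p(q_E) = 1` and
`K_w ∋ q̲ = q_E^{1/10}`, so `e_w ≥ 10`): BOTH labels hold — `q̲ ∈ q̲^{j²}·ℐ_K` for `j ≤ 2` (`3·H ≤ 3 ≤ 10·(1 − 1/3 − 1/10)`). [claim: Mochizuki2012, status: disputed] -/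
theorem allLabels_mem_l5 (hp : 5 ≤ p) (he : 10 ≤ absRamificationIdx p K) {q : K} (hq : q ≠ 0) {H : ℝ} (hH0 : 0 ≤ H) (hH1 : H ≤ 1)
    (hqN : ‖q‖ ^ (2 * 5) = (p : ℝ) ^ (-H)) :
    ∀ j ≤ 2, q ∈ q ^ (j ^ 2) • logShell (PadicLogOnUnits.ofUnitLog p K) := by
  refine allLabels_mem_of_le p K (by omega) hq (by norm_num) hH0 hqN ?_
  have hp' : (5 : ℝ) ≤ p := by exact_mod_cast hp
  have he' : (10 : ℝ) ≤ (absRamificationIdx p K : ℝ) := by exact_mod_cast he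
  have h1 : 1 / ((p : ℝ) - 2) ≤ 1 / 3 := by
    rw [div_le_div_iff₀ (by linarith) (by norm_num)]; linarith
  have h2 : 1 / (absRamificationIdx p K : ℝ) ≤ 1 / 10 := by
    rw [div_le_div_iff₀ (by linarith) (by norm_num)]; linarith
  push_cast
  nlinarith

/-- **WORKED TEMPLATE (DECIDED-NEG at the top label)**: any `p`, `l = 2k+1` with `(l−3)(l+1)·H > 8l·(b_e + c)`; e.g. with `b_e + c ≤ 3` and `H ≥ 1`
every `l ≥ 29` (`k ≥ 14`: `26·30 = 780 > 8·29·3 = 696`). Stated for `k = 14`. [claim: Mochizuki2012, status: disputed] -/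
theorem not_mem_topLabel_l29 {q : K} {H : ℝ} (hH : 1 ≤ H) (hqN : ‖q‖ ^ (2 * (2 * 14 + 1)) = (p : ℝ) ^ (-H))
    (hbc : logRadiusB p (absRamificationIdx p K) + ((if p = 2 then 2 else 1 : ℕ) : ℝ) ≤ 3) :
    q ∉ q ^ (14 ^ 2) • logShell (PadicLogOnUnits.ofUnitLog p K) := by
  refine not_mem_topLabel_of_large_l p K 14 hqN ?_
  push_cast at hbc ⊢
  linarith

end AllLabels

/-! ## 6. (APPENDED 2026-08-26, gen 3) The SHARP lower edge: every radius `a > 1/(p−1)` — positive cells over `2` and `3` as well -/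

section Sharp

variable (p : ℕ) [Fact p.Prime]
variable (K : Type*) [NontriviallyNormedField K] [NormedAlgebra ℚ_[p] K] [IsUltrametricDist K] [ProperSpace K]

/-- **`p^a·𝒪_K ⊆ log_p(𝒪_K^×)` for EVERY real `a > 1/(p−1)`** (abc-iut-S1's successive approximation `exists_logSeries_eq`: contraction constant
`p^{1/(p−1) − a} < 1`); [IUTchIV] Prop. 1.2 (i)'s printed `a_e` (`= 2` at `p = 2`, `⌈e/(p−2)⌉/e` otherwise) is one admissible value, not the limit.
[claim: Mochizuki2012, status: disputed] -/
theorem pBall_subset_logUnits_of_lt {a : ℝ} (ha : 1 / ((p : ℝ) - 1) < a) : pBall p K a ⊆ logUnits K := by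
  have hp1 : (1 : ℝ) < p := by exact_mod_cast (Fact.out : p.Prime).one_lt
  have hp0 : (0 : ℝ) < p := by linarith
  have hinv : 0 < 1 / ((p : ℝ) - 1) := div_pos one_pos (by linarith)
  have hθ : (p : ℝ) ^ (-a) * (p : ℝ) ^ (1 / ((p : ℝ) - 1)) < 1 := by
    rw [← Real.rpow_add hp0]
    exact Real.rpow_lt_one_of_one_lt_of_neg hp1 (by linarith)
  have hρ1 : (p : ℝ) ^ (-a) < 1 := Real.rpow_lt_one_of_one_lt_of_neg hp1 (by linarith)
  intro z hz
  rw [mem_pBall_iff] at hz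
  obtain ⟨u, hu1, huz⟩ := exists_logSeries_eq p K hθ hz
  have huP : IsPrincipal u := hu1.trans_lt hρ1
  exact ⟨u, huP.norm_eq_one, by rw [unitLog_of_isPrincipal p huP, huz]⟩

/-- **SHARP LOWER RADIUS OF THE LOG-SHELL**: `closedBall 0 (‖p*‖⁻¹ · p^{−a}) ⊆ ℐ_K` for every `a > 1/(p−1)`. [cite: MochizukiAbsTopIII2015, Def 5.4 (iii) p. 126] -/
theorem closedBall_subset_logShell_of_lt {a : ℝ} (ha : 1 / ((p : ℝ) - 1) < a) :
    closedBall (0 : K) (‖((p ^ (if p = 2 then 2 else 1) : ℕ) : K)‖⁻¹ * (p : ℝ) ^ (-a)) ⊆ logShell (PadicLogOnUnits.ofUnitLog p K) := by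
  intro x hx
  rw [mem_closedBall, dist_zero_right] at hx
  rw [logShell_ofUnitLog]
  have hps := norm_pstar_pos p K
  refine Set.mem_smul_set.2 ⟨((p ^ (if p = 2 then 2 else 1) : ℕ) : K) * x, ?_, ?_⟩
  · apply pBall_subset_logUnits_of_lt p K ha
    rw [mem_pBall_iff, norm_mul]
    rwa [le_inv_mul_iff₀ hps] at hx
  · rw [smul_eq_mul, ← mul_assoc, inv_mul_cancel₀ (norm_pos_iff.1 hps), one_mul]

/-- **SHARP POSITIVE CELL (every stratum)**: `(n−1)·h < c − 1/(p−1)` ⟹ `q ∈ q^n · ℐ_K` — over `2`: `(n−1)·h < 1`; over `3`: `(n−1)·h < 1/2`;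
`p ≥ 5`: `(n−1)·h < 1 − 1/(p−1)`. Supersedes the printed-`a_e` edge of §2–§3 (which is empty over `2` and `3`). [cite: MochizukiAbsTopIII2015, Def 5.4 (iii) p. 126] -/
theorem mem_pow_smul_logShell_of_height_lt_sharp {q : K} (hq : q ≠ 0) {h : ℝ} (hqh : ‖q‖ = (p : ℝ) ^ (-h)) {n : ℕ}
    (hlt : ((n : ℝ) - 1) * h < ((if p = 2 then 2 else 1 : ℕ) : ℝ) - 1 / ((p : ℝ) - 1)) :
    q ∈ q ^ n • logShell (PadicLogOnUnits.ofUnitLog p K) := by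
  have ha : 1 / ((p : ℝ) - 1) < ((if p = 2 then 2 else 1 : ℕ) : ℝ) - ((n : ℝ) - 1) * h := by linarith
  apply mem_pow_smul_of_norm_le (closedBall_subset_logShell_of_lt p K ha) hq
  have hp1 : (1 : ℝ) < p := by exact_mod_cast (Fact.out : p.Prime).one_lt
  have hp0 : (0 : ℝ) < p := by linarith
  rw [norm_pstar_inv_eq_rpow p K, hqh, ← Real.rpow_natCast, ← Real.rpow_mul hp0.le, ← Real.rpow_add hp0, ← Real.rpow_add hp0,
    Real.rpow_le_rpow_left_iff hp1]
  linarith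

/-- **SHARP POSITIVE CELL, root form** (`‖q̲‖^N = p^{−H}`): `(n−1)·H < N·(c − 1/(p−1))` ⟹ `q̲ ∈ q̲^n · ℐ_K` — for `N = 2l`, `n = j²`:
«(j²−1)·ord_p(q_E) < 2l·(c − 1/(p−1))». [claim: Mochizuki2012, status: disputed] -/
theorem mem_pow_smul_logShell_of_root_lt_sharp {q : K} (hq : q ≠ 0) {N : ℕ} (hN : 0 < N) {H : ℝ} (hqN : ‖q‖ ^ N = (p : ℝ) ^ (-H))
    {n : ℕ} (hlt : ((n : ℝ) - 1) * H < N * (((if p = 2 then 2 else 1 : ℕ) : ℝ) - 1 / ((p : ℝ) - 1))) :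
    q ∈ q ^ n • logShell (PadicLogOnUnits.ofUnitLog p K) := by
  refine mem_pow_smul_logShell_of_height_lt_sharp p K hq (norm_eq_rpow_of_pow_eq p (Nat.pos_iff_ne_zero.1 hN) hqN) ?_
  have hN' : (0 : ℝ) < N := by exact_mod_cast hN
  rw [← mul_div_assoc, div_lt_iff₀ hN']
  linarith

/-- **SHARP ALL-LABELS POSITIVE** (`‖q̲‖^{2l} = p^{−H}`, `0 ≤ H`): `(J²−1)·H < 2l·(c − 1/(p−1)) ⟹ ∀ j ≤ J, q̲ ∈ q̲^{j²} · ℐ_K` — every stratum,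
including `v | 2` (`c − 1/(p−1) = 1`) and `v | 3` (`= 1/2`). [claim: Mochizuki2012, status: disputed] -/
theorem allLabels_mem_of_lt_sharp {q : K} (hq : q ≠ 0) {l : ℕ} (hl : 0 < l) {H : ℝ} (hH : 0 ≤ H)
    (hqN : ‖q‖ ^ (2 * l) = (p : ℝ) ^ (-H)) {J : ℕ}
    (hlt : (((J ^ 2 : ℕ) : ℝ) - 1) * H < ((2 * l : ℕ) : ℝ) * (((if p = 2 then 2 else 1 : ℕ) : ℝ) - 1 / ((p : ℝ) - 1))) :
    ∀ j ≤ J, q ∈ q ^ (j ^ 2) • logShell (PadicLogOnUnits.ofUnitLog p K) := by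
  intro j hj
  apply mem_pow_smul_logShell_of_root_lt_sharp p K hq (by omega) hqN
  have hjJ : ((j ^ 2 : ℕ) : ℝ) ≤ ((J ^ 2 : ℕ) : ℝ) := by exact_mod_cast Nat.pow_le_pow_left hj 2
  have hmono : (((j ^ 2 : ℕ) : ℝ) - 1) * H ≤ (((J ^ 2 : ℕ) : ℝ) - 1) * H := mul_le_mul_of_nonneg_right (by linarith) hH
  exact hmono.trans_lt hlt

/-- **WORKED TEMPLATE over `2` (DECIDED-POS)**: `l = 5`, `K` over `ℚ_2`, `0 ≤ H < 10/3` (e.g. `ord_2(q_E) ≤ 3`): BOTH labels hold — the sharp edge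
gives `3·H < 2·5·(2 − 1) = 10`. [claim: Mochizuki2012, status: disputed] -/
theorem allLabels_mem_l5_two (K₂ : Type*) [NontriviallyNormedField K₂] [NormedAlgebra ℚ_[2] K₂] [IsUltrametricDist K₂] [ProperSpace K₂]
    {q : K₂} (hq : q ≠ 0) {H : ℝ} (hH0 : 0 ≤ H) (hH : H < 10 / 3) (hqN : ‖q‖ ^ (2 * 5) = ((2 : ℕ) : ℝ) ^ (-H)) :
    ∀ j ≤ 2, q ∈ q ^ (j ^ 2) • logShell (PadicLogOnUnits.ofUnitLog 2 K₂) := by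
  refine allLabels_mem_of_lt_sharp 2 K₂ hq (by norm_num) hH0 hqN ?_
  rw [pstarExp_two]
  push_cast
  nlinarith

/-- **WORKED TEMPLATE over `3` (DECIDED-POS)**: `l = 5`, `K` over `ℚ_3`, `0 ≤ H < 5/3` (e.g. `ord_3(q_E) = 1`): BOTH labels hold (`3·H < 10·(1 − 1/2) = 5`).
[claim: Mochizuki2012, status: disputed] -/
theorem allLabels_mem_l5_three (K₃ : Type*) [NontriviallyNormedField K₃] [NormedAlgebra ℚ_[3] K₃] [IsUltrametricDist K₃] [ProperSpace K₃]
    {q : K₃} (hq : q ≠ 0) {H : ℝ} (hH0 : 0 ≤ H) (hH : H < 5 / 3) (hqN : ‖q‖ ^ (2 * 5) = ((3 : ℕ) : ℝ) ^ (-H)) :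
    ∀ j ≤ 2, q ∈ q ^ (j ^ 2) • logShell (PadicLogOnUnits.ofUnitLog 3 K₃) := by
  refine allLabels_mem_of_lt_sharp 3 K₃ hq (by norm_num) hH0 hqN ?_
  rw [pstarExp_of_ne_two (by norm_num)]
  push_cast
  nlinarith

end Sharp

end Summit.ABC.IUTFork.Repair.CandInternal2RealStrata

end
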